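import Literature.AnabelianGeometry.SemiGraphs.TemperedVerticialSlimProofs
import Literature.AnabelianGeometry.SemiGraphs.TemperoidsHomEqResProofs
import Literature.AnabelianGeometry.SemiGraphs.TemperedFunctorialityHolds
import HarnessLib

/-!
# [SemiAnbd] Prop. 3.6 (iv) (last sentence) and Thm. 3.7 (i): the named facts `TemperedPiSlim` and
# `VerticialInjective` DISCHARGED

Mochizuki, *Semi-graphs of anabelioids*, Publ. RIMS **42** (2006), §3, manuscript pp. 39–40
[cite: MochizukiSemiAnbd2006, Thm 3.7(i) p.40].  Assembly file (proof-only): the reductions of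
`TemperedVerticialExistsProofs.lean` / `TemperedVerticialSlimProofs.lean` (seat abc-iut-L3-t8) composed
with Proposition 3.2, surjectivity half (`TemperoidHomEqRes_holds`, `TemperoidsHomEqResProofs.lean`,
seat abc-iut-L3-d2):
* `verticialInjective_holds : VerticialInjective` — **Theorem 3.7 (i)** ("for each vertex `v` of `G`,
  there is a natural continuous, injective outer homomorphism `π̂₁(G_v) ↪ π₁^temp(G)`");
* `temperedPiSlim_holds : TemperedPiSlim` — **Proposition 3.6 (iv), last sentence** ("the temperoid
  `B^temp(G)` is temp-slim");
* `verticialHomRelativelyTempSlim_holds` — the rung-5 (c) residual of the Prop. 3.6 (iv) clause-2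
  reduction (`VerticialHomRelativelyTempSlim`, seat abc-iut-L3-t6), for every `G` as in Prop. 3.6;
* `inducedHomOfMorphism_holds : InducedHomOfMorphism` — **Proposition 3.6 (iv)** as typed (both
  clauses), composing seat abc-iut-L3-t10's assembly `inducedHomOfMorphism_of_slim`
  (`TemperedFunctorialityHolds.lean`, with abc-iut-L6-d4's clause 1 and abc-iut-L3-t6's clause-2
  reduction) with `verticialHomRelativelyTempSlim_holds`;
* `exists_isVerticialHom`, `verticialSubgroups_nonempty`, `exists_isEdgeHom` — the existence halves
  of Thm. 3.7 (i)/(iii)'s vocabulary, unconditionally.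
Nothing here takes a side on any disputed step; the statements are [SemiAnbd]'s own.
-/

namespace Literature.AnabelianGeometry.SemiGraphs

namespace ProfiniteSemiGraph

universe u

variable {𝒢 : ProfiniteSemiGraph.{u}}

/-- **Theorem 3.7 (i)** ([SemiAnbd] §3 p. 40) — the named fact `VerticialInjective` PROVED: every
vertex of a `G` as in Thm. 3.7 carries a verticial homomorphism (Prop. 3.2 applied to the morphism of
temperoids `B^temp(G) → G_v^⊤`), and every verticial homomorphism is injective.
[cite: MochizukiSemiAnbd2006, Thm 3.7(i) p.40] -/
theorem verticialInjective_holds : VerticialInjective.{u} :=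
  verticialInjective_of TemperoidHomEqRes_holds

/-- `VerticialInjective` — `_holds` alias of `verticialInjective_holds` above under the fact's exact name (appended
2026-08-28, D-0026 bookkeeping: the proof term is the existing theorem of this file; no statement,
definition or attribute is edited; no new named fact; the ledger's debt table listed the fact
unproved). [cite: MochizukiSemiAnbd2006, Thm 3.7(i) p.40] -/
theorem _root_.Literature.AnabelianGeometry.SemiGraphs.ProfiniteSemiGraph.VerticialInjective_holds :
    VerticialInjective.{u} :=
  _root_.Literature.AnabelianGeometry.SemiGraphs.ProfiniteSemiGraph.verticialInjective_holds

/-- **Proposition 3.6 (iv), last sentence** ([SemiAnbd] §3 p. 39) — the named fact `TemperedPiSlim`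
PROVED: every tempered fundamental group of a `G` as in Prop. 3.6 is (temp-)slim.
[cite: MochizukiSemiAnbd2006, Prop 3.6(iv) p.39] -/
theorem temperedPiSlim_holds : TemperedPiSlim.{u} :=
  temperedPiSlim_of TemperoidHomEqRes_holds

/-- `TemperedPiSlim` — `_holds` alias of `temperedPiSlim_holds` above under the fact's exact name (appended
2026-08-28, D-0026 bookkeeping: the proof term is the existing theorem of this file; no statement,
definition or attribute is edited; no new named fact; the ledger's debt table listed the fact
unproved). [cite: MochizukiSemiAnbd2006, Prop 3.6(iv) p.39] -/
theorem _root_.Literature.AnabelianGeometry.SemiGraphs.ProfiniteSemiGraph.TemperedPiSlim_holds :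
    TemperedPiSlim.{u} :=
  _root_.Literature.AnabelianGeometry.SemiGraphs.ProfiniteSemiGraph.temperedPiSlim_holds

/-- The residual `VerticialHomRelativelyTempSlim` (Prop. 3.6 (iv), vertex case: existence of
verticial homomorphisms, all relatively temp-slim) holds for every `G` as in Prop. 3.6 and every
chart. [cite: MochizukiSemiAnbd2006, Prop 3.6(iv) p.39] -/
theorem verticialHomRelativelyTempSlim_holds (h𝒢 : 𝒢.Prop36Hypotheses) (c : TemperedPiChart 𝒢) :
    VerticialHomRelativelyTempSlim 𝒢 c :=
  verticialHomRelativelyTempSlim_of_temperoidHomEqRes TemperoidHomEqRes_holds h𝒢 c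

/-- **Theorem 3.7 (i), existence**: every vertex of a Galois-countable, quasi-coherent `G` carries a
verticial homomorphism `Π_v → π₁^temp(G)`, for every chart. [cite: MochizukiSemiAnbd2006, Thm 3.7(i) p.40] -/
theorem exists_isVerticialHom (hqc : 𝒢.IsQuasiCoherent) (hgc : 𝒢.IsGaloisCountable)
    (c : TemperedPiChart 𝒢) (v : 𝒢.graph.Vertex) : ∃ φ : 𝒢.Gv v →ₜ* c.G, IsVerticialHom c v φ :=
  exists_isVerticialHom_of c v (TemperoidHomEqRes_holds _ _) hqc hgc

/-- Hence the verticial subgroups at every vertex are nonempty. [cite: MochizukiSemiAnbd2006, Thm 3.7(i) p.40] -/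
theorem verticialSubgroups_nonempty (hqc : 𝒢.IsQuasiCoherent) (hgc : 𝒢.IsGaloisCountable)
    (c : TemperedPiChart 𝒢) (v : 𝒢.graph.Vertex) : (verticialSubgroups c v).Nonempty :=
  verticialSubgroups_nonempty_of c v (TemperoidHomEqRes_holds _ _) hqc hgc

/-- **Theorem 3.7 (iii) vocabulary, existence of edge homomorphisms** at every edge with an abutting
branch, for `G` of injective type, Galois-countable and quasi-coherent.
[cite: MochizukiSemiAnbd2006, Thm 3.7(iii) p.41] -/
theorem exists_isEdgeHom (hqc : 𝒢.IsQuasiCoherent) (hgc : 𝒢.IsGaloisCountable)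
    (hinj : 𝒢.IsOfInjectiveType) (c : TemperedPiChart 𝒢) (b : 𝒢.graph.Branch)
    (v : 𝒢.graph.Vertex) (h : 𝒢.graph.abuts b = some v) :
    ∃ φ : 𝒢.Ge (𝒢.graph.edgeOf b) →ₜ* c.G, IsEdgeHom c (𝒢.graph.edgeOf b) φ :=
  exists_isEdgeHom_of c b v h (TemperoidHomEqRes_holds _ _) hqc hgc hinj

/-- **Proposition 3.6 (iv)** ([SemiAnbd] §3 p. 39) — the named fact `InducedHomOfMorphism` PROVED
(both clauses: the induced `π₁^temp(G') → π₁^temp(G)` compatible with the verticial homomorphisms, and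
its relative temp-slimness for locally open morphisms): the assembly `inducedHomOfMorphism_of_slim`
(seat abc-iut-L3-t10) applied to `verticialHomRelativelyTempSlim_holds`.
[cite: MochizukiSemiAnbd2006, Prop 3.6(iv) p.39] -/
theorem inducedHomOfMorphism_holds : InducedHomOfMorphism.{u} :=
  inducedHomOfMorphism_of_slim fun _ h𝒢 c => verticialHomRelativelyTempSlim_holds h𝒢 c

/-- `InducedHomOfMorphism` — `_holds` alias of `inducedHomOfMorphism_holds` above under the fact's exact name (appended
2026-08-28, D-0026 bookkeeping: the proof term is the existing theorem of this file; no statement,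
definition or attribute is edited; no new named fact; the ledger's debt table listed the fact
unproved). [cite: MochizukiSemiAnbd2006, Prop 3.6(iv) p.39] -/
theorem _root_.Literature.AnabelianGeometry.SemiGraphs.ProfiniteSemiGraph.InducedHomOfMorphism_holds :
    InducedHomOfMorphism.{u} :=
  _root_.Literature.AnabelianGeometry.SemiGraphs.ProfiniteSemiGraph.inducedHomOfMorphism_holds

end ProfiniteSemiGraph

end Literature.AnabelianGeometry.SemiGraphs
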